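import Summits.QuantumFields.YangMills.Theorems.BalabanUVNodesN15UnitLayerBgQGQPosition
import Summits.QuantumFields.YangMills.Theorems.BalabanUVNodesN15UnitLayerBgDressing
import Summits.QuantumFields.YangMills.Theorems.BalabanUVNodesN15VectorPieceBackgroundMatrix
import Mathlib.LinearAlgebra.Matrix.Kronecker
import HarnessLib

/-!
# N15 (NE2) — PROGRAMME Σ-col, part (G): THE COLOURED UNIT-BOND DICTIONARY — unit-lattice operators on 𝔤-valued 1-forms `(Tor M × Fin (d+1)) × ι → ℝ` as bond matrices over
# `B4.Idx (pbox M) (d+1) × ι`; `unitBondMatC (T ⊗ 1_ι) = unitBondMat T ⊗ₖ 1`; the (1.66) matrix with colour `(b·1 + Δ^{(n)}) ⊗ₖ 1 = (unitBondMatC ((QGQ*) ⊗ 1_ι))⁻¹`, its decay, η-rate,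
# nonnegative form, symmetry, and the row sums of the lifted pseudo-metric — the `U ≡ 1` inputs V-B's generic exact-dressing letters need on a COLOURED carrier (dag-n15-c's `sfInstance`)

WHO ∕ WHEN.  Cell `pub-ymgap`, seat `pub-ymgap-dag-n15-a` (KNIT-BY-NAME seat of Track-A DAG node N15 = NE2, g28); `--supports stmt-QuantumFields-27366 --as helper` (K3⁸; count-neutral).
Three plumbing `def`s (`unitBondMatC`, `idxEquivC`, `cdist`) + theorems.  Over V-A `…UnitLayerBgQGQPosition` (`unitBondMat`, `boxBondTor`, `sOp`, `unitBondMat_sOp_mul`, `mul_unitBondMat_sOp`,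
`form_deltaPol_nonneg`), U-B0 `…UnitLayerBgDressing` (`bondDist_comm`, `bondDist_self`), part 24 `…VectorPieceBackgroundMatrix` (`tensorId`, `tensorId_apply`), `B6Cov2156Torus(DelK)`
(`deltaPol`, `deltaPol_isSymm`, `idxEquiv`), `B5Kernel166Decay.kernelDecay166`, `T4Cov2156Rate` (`kernelRate166`, `bondDist_nonneg∕triangle`, `bondSum_le`), Mathlib's `Matrix.kroneckerMap`
(`⊗ₖ`, `mul_kronecker_mul`, `one_kronecker_one`) BY NAME; nothing in the tree is modified.

WHY (programme Σ-col).  Director-ym №252: FLAG №13's located burden «non-abelian `G(U)` dressing of NE2 ← N15 U-blind pin» has dag-n15-c's road (c) as its home; Σ-E∕Σ-F knit that family's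
four-entry NON-ABELIAN-live operator layer into `N15At` with the SITE ∕ UNIT layers still the U-blind `U ≡ 1` kernels (said there).  Making them U-live on n15-c's carrier is Σ-A∕Σ-C's mechanism
on the COLOURED bond index `B4.Idx × ι`: V-B's finite Combes–Thomas letters `abs_exDress_le` ∕ `abs_exDress_sub_le` are already GENERIC (any finite index, any pseudo-metric, any symmetric
nonnegative-form `Δ` with decay); what they need is (G) the dictionary below, (H) their instantiation on `(Δ^{(n)} ⊗ₖ 1, cdist)`, (I) the middle factor `Z(A) = unitBondMatC((Q⊗1)(𝒢(A) −
𝒢(0))(Q*⊗1))`'s letters from n15-c's FILE 130∕133 rows, (J) the knit.  THIS FILE is (G).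

WHAT.  §1 def `unitBondMatC M ι T` (`((b,i),(b′,j)) ↦ (T δ_{(b′,j)})(b,i)`), def `idxEquivC`, `unitBondMatC_eq_submatrix`, `_comp`, `_id`, `_add`, `_sub`, `_zero`.  §2 `toMatrix'_tensorId_apply`,
★ `unitBondMatC_tensorId` (`= unitBondMat T ⊗ₖ 1`).  §3 Kronecker-with-`1` bookkeeping over any index `X` (instances taken from the goal): `kron_one_apply`, ★ `abs_kron_one_le` (decay transfer),
`kron_one_sub_apply`, `kron_one_isSymm`, `kron_one_mulVec`, ★ `form_kron_one_nonneg`, ★ `kron_one_inv_eq` (`A·B = 1 ⇒ (A ⊗ₖ 1)⁻¹ = B ⊗ₖ 1`).  §4 def `cdist` (= `ρ_M` of the underlying bonds,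
colour-blind pseudo-metric), `cdist_nonneg∕_comm∕_self∕_triangle`, ★ `colSum_le` (`Σ_{(q,j)} e^{−a·cdist} ≤ |ι|·(d+1)·latticeConst (d+1) a`).  §5 ★★ `inv_unitBondMatC_tensorId_sOp`
(`(unitBondMatC ((Q_nG_nQ_n*) ⊗ 1_ι))⁻¹ = (b·1 + Δ^{(n)}) ⊗ₖ 1` — V-A's (1.102)–(1.103) identity with colour), `deltaCol_mul_unitBondMatC_sOp`, `unitBondMatC_sOp_mul_deltaCol`, `deltaCol_eq_smul_one_add`
(`= b·1 + Δ ⊗ₖ 1`, the shape `exDress b (Δ ⊗ₖ 1)` reads), ★ `form_deltaCol_nonneg`, `deltaCol_isSymm`, ★★ `kernelDecay166_col`, ★★ `kernelRate166_col` (uniform in torus, colour type, level).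

HONEST FRAMING ∕ LIMITS.  Linear-algebra bookkeeping (Kronecker products with the identity, re-indexing); the only analytic inputs are the landed `kernelDecay166`, `kernelRate166`,
`form_deltaPol_nonneg`, `bondSum_le`, transported entrywise.  Nothing of [B5]∕[B6]∕[B9] asserted; NO layer of NE2 is proved here; this is infrastructure for (H)–(J), which do not exist yet;
dag-n15-c's family, Bałaban's non-abelian `G(U)`, the N15 claim of record (I.44870, road (a)) and every count are untouched (typed 28∕28 · discharged 7∕28 = 7∕27 excl. NODE O); K3⁸ OPEN; one
finite 𝕋⁴ at fixed ε — NOT ℝ⁴ ∕ infinite volume ∕ OS ∕ mass gap ∕ Clay.  Three plumbing `def`s ⇒ review ∕ audit lane.  No `sorry`, `instance`, `notation`, `maxHeartbeats`; standard axioms.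
-/

noncomputable section

open scoped BigOperators Matrix Kronecker

namespace Summit.QuantumFields.YangMills.BalabanUVNodes.N15.UnitLayerBgCol

open Literature.MathematicalPhysics.QuantumFieldTheory.Balaban1983to89
open Literature.MathematicalPhysics.QuantumFieldTheory.Balaban1983to89.B5Prop11Plancherel (Tor fine)
open Literature.MathematicalPhysics.QuantumFieldTheory.Balaban1983to89.B6Lemma24Torus (pbox)
open Literature.MathematicalPhysics.QuantumFieldTheory.Balaban1983to89.B6BondEliminationTorus (pdist)
open Literature.MathematicalPhysics.QuantumFieldTheory.Balaban1983to89.B6Cov2156Torus (deltaPol deltaPol_isSymm one_le_M)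
open Literature.MathematicalPhysics.QuantumFieldTheory.Balaban1983to89.B5Kernel166Decay (kernelDecay166)
open Literature.MathematicalPhysics.QuantumFieldTheory.Balaban1983to89.T4Cov2156Rate (kernelRate166 bondDist_nonneg bondDist_triangle bondSum_le)
open Literature.MathematicalPhysics.QuantumFieldTheory.Balaban1983to89.B4Sect5Proof (latticeConst latticeConst_nonneg)
open Summit.QuantumFields.YangMills.BalabanUVNodes.N15.UnitLayerBg (unitBondMat boxBondTor sOp inv_unitBondMat_sOp unitBondMat_sOp_mul mul_unitBondMat_sOp form_deltaPol_nonneg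
  bondDist_comm bondDist_self)
open Summit.QuantumFields.YangMills.BalabanUVNodes.N15.VectorPiece (tensorId tensorId_apply)

variable {d : ℕ} (M : Fin (d + 1) → ℕ) [∀ μ, NeZero (M μ)] (ι : Type) [Fintype ι] [DecidableEq ι]

/-! ## §1 The coloured bond matrix of a unit-lattice operator on 𝔤-valued 1-forms -/

/-- A UNIT-LATTICE OPERATOR ON 𝔤-VALUED 1-FORMS AS A COLOURED BOND MATRIX: `unitBondMatC T ((b,i),(b′,j)) = (T δ_{(b′,j)})(b,i)` read at the torus bonds (U-C2's `unitBondMat` with a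
colour index `ι ≅` a basis of `𝔤`). [cite: Balaban1984PropagatorsII, (2.156) p.250 (the unit-lattice propagator on 𝔤-valued forms: shape)] -/
def unitBondMatC (T : ((Tor M × Fin (d + 1)) × ι → ℝ) →ₗ[ℝ] ((Tor M × Fin (d + 1)) × ι → ℝ)) :
    Matrix (B4.Idx (pbox M) (d + 1) × ι) (B4.Idx (pbox M) (d + 1) × ι) ℝ :=
  fun p q => LinearMap.toMatrix' T (boxBondTor M p.1, p.2) (boxBondTor M q.1, q.2)

/-- the coloured box-bond ↦ torus-bond map (b06's `idxEquiv` × the colour). [folklore] -/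
def idxEquivC : B4.Idx (pbox M) (d + 1) × ι ≃ (Tor M × Fin (d + 1)) × ι :=
  Equiv.prodCongr (B6Cov2156TorusDelK.idxEquiv M) (Equiv.refl ι)

omit [Fintype ι] [DecidableEq ι] in
/-- Evaluation of `idxEquivC`. [folklore] -/
theorem idxEquivC_apply (p : B4.Idx (pbox M) (d + 1) × ι) : idxEquivC M ι p = (boxBondTor M p.1, p.2) := rfl

/-- `unitBondMatC T` is the standard matrix of `T` re-indexed along `idxEquivC`. [folklore] -/
theorem unitBondMatC_eq_submatrix (T : ((Tor M × Fin (d + 1)) × ι → ℝ) →ₗ[ℝ] ((Tor M × Fin (d + 1)) × ι → ℝ)) :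
    unitBondMatC M ι T = (LinearMap.toMatrix' T).submatrix (idxEquivC M ι) (idxEquivC M ι) := rfl

/-- composition ↦ product. [folklore] -/
theorem unitBondMatC_comp (T T' : ((Tor M × Fin (d + 1)) × ι → ℝ) →ₗ[ℝ] ((Tor M × Fin (d + 1)) × ι → ℝ)) :
    unitBondMatC M ι (T ∘ₗ T') = unitBondMatC M ι T * unitBondMatC M ι T' := by
  rw [unitBondMatC_eq_submatrix, unitBondMatC_eq_submatrix, unitBondMatC_eq_submatrix, LinearMap.toMatrix'_comp, Matrix.submatrix_mul_equiv]

/-- identity ↦ `1`. [folklore] -/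
theorem unitBondMatC_id : unitBondMatC M ι (LinearMap.id : ((Tor M × Fin (d + 1)) × ι → ℝ) →ₗ[ℝ] ((Tor M × Fin (d + 1)) × ι → ℝ)) = 1 := by
  rw [unitBondMatC_eq_submatrix, LinearMap.toMatrix'_id, Matrix.submatrix_one_equiv]

/-- additivity. [folklore] -/
theorem unitBondMatC_add (T T' : ((Tor M × Fin (d + 1)) × ι → ℝ) →ₗ[ℝ] ((Tor M × Fin (d + 1)) × ι → ℝ)) :
    unitBondMatC M ι (T + T') = unitBondMatC M ι T + unitBondMatC M ι T' := by
  ext p q; simp [unitBondMatC, Matrix.add_apply]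

/-- `unitBondMatC (T − T′) = unitBondMatC T − unitBondMatC T′`. [folklore] -/
theorem unitBondMatC_sub (T T' : ((Tor M × Fin (d + 1)) × ι → ℝ) →ₗ[ℝ] ((Tor M × Fin (d + 1)) × ι → ℝ)) :
    unitBondMatC M ι (T - T') = unitBondMatC M ι T - unitBondMatC M ι T' := by
  ext p q; simp [unitBondMatC, Matrix.sub_apply]

/-- `unitBondMatC 0 = 0`. [folklore] -/
theorem unitBondMatC_zero : unitBondMatC M ι (0 : ((Tor M × Fin (d + 1)) × ι → ℝ) →ₗ[ℝ] ((Tor M × Fin (d + 1)) × ι → ℝ)) = 0 := by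
  ext p q; simp [unitBondMatC]

/-! ## §2 ★ The lift `T ⊗ 1_ι` is the Kronecker product with `1` -/

omit [Fintype ι] in
/-- the standard matrix of the componentwise lift: `toMatrix' (T ⊗ 1_ι) ((x,i),(x′,j)) = δ_{ij}·toMatrix' T (x,x′)`. [folklore] -/
theorem toMatrix'_tensorId_apply {X : Type} [Fintype X] [DecidableEq X] [Fintype ι] (T : (X → ℝ) →ₗ[ℝ] (X → ℝ)) (p q : X × ι) :
    LinearMap.toMatrix' (tensorId ι T) p q = LinearMap.toMatrix' T p.1 q.1 * (1 : Matrix ι ι ℝ) p.2 q.2 := by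
  rw [LinearMap.toMatrix'_apply, LinearMap.toMatrix'_apply, tensorId_apply, Matrix.one_apply]
  by_cases h : p.2 = q.2
  · rw [if_pos h, mul_one]
    have hfun : (fun x => (Pi.single q (1 : ℝ) : X × ι → ℝ) (x, p.2)) = Pi.single q.1 (1 : ℝ) := by
      funext x
      by_cases hx : x = q.1
      · subst hx
        have hq : (q.1, p.2) = q := Prod.ext rfl h
        rw [hq, Pi.single_eq_same, Pi.single_eq_same]
      · have hne : (x, p.2) ≠ q := by rintro rfl; exact hx rfl
        rw [Pi.single_eq_of_ne hne, Pi.single_eq_of_ne hx]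
    rw [hfun]
  · rw [if_neg h, mul_zero]
    have hfun : (fun x => (Pi.single q (1 : ℝ) : X × ι → ℝ) (x, p.2)) = 0 := by
      funext x
      have hne : (x, p.2) ≠ q := by rintro rfl; exact h rfl
      rw [Pi.single_eq_of_ne hne, Pi.zero_apply]
    rw [hfun, map_zero, Pi.zero_apply]

/-- ★ **`unitBondMatC (T ⊗ 1_ι) = unitBondMat T ⊗ₖ 1`** — the coloured bond matrix of a componentwise lift is the Kronecker product of U-C2's bond matrix with the colour identity. [folklore] -/
theorem unitBondMatC_tensorId (T : (Tor M × Fin (d + 1) → ℝ) →ₗ[ℝ] (Tor M × Fin (d + 1) → ℝ)) :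
    unitBondMatC M ι (tensorId ι T) = unitBondMat M T ⊗ₖ (1 : Matrix ι ι ℝ) := by
  ext p q
  rw [Matrix.kroneckerMap_apply]
  exact toMatrix'_tensorId_apply ι T (boxBondTor M p.1, p.2) (boxBondTor M q.1, q.2)

/-! ## §3 Kronecker-with-`1` bookkeeping: entries, decay, symmetry, nonnegative form, inverse -/

section Kron

variable {X : Type}

omit [Fintype ι] in
/-- entries of `A ⊗ₖ 1`. [folklore] -/
theorem kron_one_apply (A : Matrix X X ℝ) (p q : X × ι) : (A ⊗ₖ (1 : Matrix ι ι ℝ)) p q = if p.2 = q.2 then A p.1 q.1 else 0 := by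
  rw [Matrix.kroneckerMap_apply, Matrix.one_apply, mul_ite, mul_one, mul_zero]

omit [Fintype ι] in
/-- ★ DECAY TRANSFER: an entry majorant of `A` by a nonnegative kernel of the base indices is one of `A ⊗ₖ 1` (read through the first components). [folklore] -/
theorem abs_kron_one_le {A : Matrix X X ℝ} {f : X → X → ℝ} (hf : ∀ x y, 0 ≤ f x y) (hA : ∀ x y, |A x y| ≤ f x y) (p q : X × ι) :
    |(A ⊗ₖ (1 : Matrix ι ι ℝ)) p q| ≤ f p.1 q.1 := by
  rw [kron_one_apply]
  split_ifs
  · exact hA p.1 q.1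
  · rw [abs_zero]; exact hf p.1 q.1

omit [Fintype ι] in
/-- difference of two lifts: `A′ ⊗ₖ 1 − A ⊗ₖ 1 = (A′ − A) ⊗ₖ 1` entrywise. [folklore] -/
theorem kron_one_sub_apply (A A' : Matrix X X ℝ) (p q : X × ι) :
    (A' ⊗ₖ (1 : Matrix ι ι ℝ)) p q - (A ⊗ₖ (1 : Matrix ι ι ℝ)) p q = ((A' - A) ⊗ₖ (1 : Matrix ι ι ℝ)) p q := by
  rw [kron_one_apply, kron_one_apply, kron_one_apply, Matrix.sub_apply]
  split_ifs <;> ring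

omit [Fintype ι] in
/-- symmetry transfer. [folklore] -/
theorem kron_one_isSymm {A : Matrix X X ℝ} (hA : A.IsSymm) : (A ⊗ₖ (1 : Matrix ι ι ℝ)).IsSymm := by
  ext p q
  rw [Matrix.transpose_apply, kron_one_apply, kron_one_apply]
  by_cases h : p.2 = q.2
  · rw [if_pos h, if_pos h.symm]; exact hA.apply p.1 q.1
  · rw [if_neg h, if_neg (Ne.symm h)]

/-- `(A ⊗ₖ 1) *ᵥ x` acts colour by colour (the base type's `Fintype` instance is taken from the goal). [folklore] -/
theorem kron_one_mulVec {_ : Fintype X} (A : Matrix X X ℝ) (x : X × ι → ℝ) (p : X × ι) :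
    ((A ⊗ₖ (1 : Matrix ι ι ℝ)) *ᵥ x) p = (A *ᵥ fun y => x (y, p.2)) p.1 := by
  rw [Matrix.mulVec, Matrix.mulVec, dotProduct, dotProduct, Fintype.sum_prod_type]
  refine Finset.sum_congr rfl fun y _ => ?_
  rw [Finset.sum_eq_single p.2]
  · rw [kron_one_apply, if_pos rfl]
  · intro j _ hj; rw [kron_one_apply, if_neg (Ne.symm hj), zero_mul]
  · intro h; exact absurd (Finset.mem_univ _) h

/-- ★ NONNEGATIVE-FORM TRANSFER: `x ⬝ᵥ ((Δ ⊗ₖ 1) *ᵥ x) = Σ_i x(·,i) ⬝ᵥ (Δ *ᵥ x(·,i)) ≥ 0`. [folklore] -/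
theorem form_kron_one_nonneg {_ : Fintype X} {Δ : Matrix X X ℝ} (hΔ : ∀ y : X → ℝ, 0 ≤ y ⬝ᵥ (Δ *ᵥ y)) (x : X × ι → ℝ) :
    0 ≤ x ⬝ᵥ ((Δ ⊗ₖ (1 : Matrix ι ι ℝ)) *ᵥ x) := by
  have h : x ⬝ᵥ ((Δ ⊗ₖ (1 : Matrix ι ι ℝ)) *ᵥ x) = ∑ i : ι, (fun y => x (y, i)) ⬝ᵥ (Δ *ᵥ fun y => x (y, i)) := by
    rw [dotProduct, Fintype.sum_prod_type, Finset.sum_comm]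
    refine Finset.sum_congr rfl fun i _ => ?_
    rw [dotProduct]
    refine Finset.sum_congr rfl fun y _ => ?_
    rw [kron_one_mulVec]
  rw [h]
  exact Finset.sum_nonneg fun i _ => hΔ _

/-- ★ INVERSE TRANSFER: `(A ⊗ₖ 1)⁻¹ = A⁻¹ ⊗ₖ 1` when `A * B = 1` (so `B = A⁻¹`). [folklore] -/
theorem kron_one_inv_eq {_ : Fintype X} {_ : DecidableEq X} {A B : Matrix X X ℝ} (hAB : A * B = 1) :
    (A ⊗ₖ (1 : Matrix ι ι ℝ))⁻¹ = B ⊗ₖ (1 : Matrix ι ι ℝ) :=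
  Matrix.inv_eq_right_inv (by rw [← Matrix.mul_kronecker_mul, hAB, Matrix.one_mul, Matrix.one_kronecker_one])

end Kron

/-! ## §4 The lifted pseudo-metric on coloured bonds and its row sums -/

/-- THE LIFTED BOND DISTANCE on coloured bonds: `ρ_M` of the underlying bonds (colour-blind; a pseudo-metric — two colours at one bond are at distance 0). [folklore] -/
def cdist (p q : B4.Idx (pbox M) (d + 1) × ι) : ℝ := pdist M (one_le_M M) (p.1.1 : Fin (d + 1) → ℤ) (q.1.1 : Fin (d + 1) → ℤ)

omit [Fintype ι] [DecidableEq ι] in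
/-- Unfolding. [folklore] -/
theorem cdist_eq (p q : B4.Idx (pbox M) (d + 1) × ι) : cdist M ι p q = pdist M (one_le_M M) (p.1.1 : Fin (d + 1) → ℤ) (q.1.1 : Fin (d + 1) → ℤ) := rfl

omit [Fintype ι] [DecidableEq ι] in
/-- `cdist ≥ 0`. [folklore] -/
theorem cdist_nonneg (p q : B4.Idx (pbox M) (d + 1) × ι) : 0 ≤ cdist M ι p q := bondDist_nonneg (one_le_M M) p.1 q.1

omit [Fintype ι] [DecidableEq ι] in
/-- `cdist` is symmetric. [folklore] -/
theorem cdist_comm (p q : B4.Idx (pbox M) (d + 1) × ι) : cdist M ι p q = cdist M ι q p := bondDist_comm (one_le_M M) p.1 q.1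

omit [Fintype ι] [DecidableEq ι] in
/-- `cdist p p = 0`. [folklore] -/
theorem cdist_self (p : B4.Idx (pbox M) (d + 1) × ι) : cdist M ι p p = 0 := bondDist_self (one_le_M M) p.1

omit [Fintype ι] [DecidableEq ι] in
/-- triangle inequality. [folklore] -/
theorem cdist_triangle (p q r : B4.Idx (pbox M) (d + 1) × ι) : cdist M ι p r ≤ cdist M ι p q + cdist M ι q r := bondDist_triangle (one_le_M M) p.1 q.1 r.1

omit [DecidableEq ι] in
/-- ★ ROW SUMS OF THE LIFTED KERNEL: `Σ_{(q,j)} e^{−a·cdist} = |ι| · Σ_q e^{−a·ρ_M} ≤ |ι| · (d+1)·latticeConst (d+1) a` (King's `bondSum_le`; `a > 0`). [cite: Balaban1984PropagatorsII, Lemma 2.1 (2.61) p.234 (lattice sums)] -/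
theorem colSum_le {a : ℝ} (ha : 0 < a) (p : B4.Idx (pbox M) (d + 1) × ι) :
    ∑ q : B4.Idx (pbox M) (d + 1) × ι, Real.exp (-(a * cdist M ι p q)) ≤ Fintype.card ι * (((d : ℝ) + 1) * latticeConst (d + 1) a) := by
  rw [Fintype.sum_prod_type_right]
  have h : ∀ j : ι, ∑ q : B4.Idx (pbox M) (d + 1), Real.exp (-(a * cdist M ι p (q, j))) ≤ ((d : ℝ) + 1) * latticeConst (d + 1) a := fun j => by
    have hb := bondSum_le (M := M) (one_le_M M) ha p.1
    push_cast at hb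
    exact hb
  calc ∑ j : ι, ∑ q : B4.Idx (pbox M) (d + 1), Real.exp (-(a * cdist M ι p (q, j)))
      ≤ ∑ _j : ι, ((d : ℝ) + 1) * latticeConst (d + 1) a := Finset.sum_le_sum fun j _ => h j
    _ = Fintype.card ι * (((d : ℝ) + 1) * latticeConst (d + 1) a) := by rw [Finset.sum_const, Finset.card_univ, nsmul_eq_mul]

/-! ## §5 ★★ The (1.66) matrix with colour: `(b·1 + Δ^{(n)}) ⊗ₖ 1 = (unitBondMatC ((Q G Q*) ⊗ 1_ι))⁻¹`, decay, η-rate, nonnegative form, symmetry -/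

section DeltaCol

variable (n : ℕ) [NeZero n] (b : ℝ)

/-- ★★ **THE (1.102)–(1.103) IDENTITY WITH COLOUR**: `(unitBondMatC ((Q_n G_n Q_n*) ⊗ 1_ι))⁻¹ = (b·1 + Δ^{(n)}) ⊗ₖ 1` — V-A's `inv_unitBondMat_sOp` lifted componentwise (`n ≥ 1`, `b > 0`).
[cite: Balaban1984PropagatorsI, (1.102)–(1.103) p.34, (1.65)–(1.66) p.29] -/
theorem inv_unitBondMatC_tensorId_sOp (hn : 1 ≤ n) (hb : 0 < b) :
    (unitBondMatC M ι (tensorId ι (sOp M n b)))⁻¹ = (b • (1 : Matrix (B4.Idx (pbox M) (d + 1)) (B4.Idx (pbox M) (d + 1)) ℝ) + deltaPol M n) ⊗ₖ (1 : Matrix ι ι ℝ) := by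
  rw [unitBondMatC_tensorId]
  exact kron_one_inv_eq ι (unitBondMat_sOp_mul M n hn hb)

/-- `((b·1 + Δ) ⊗ₖ 1) * (unitBondMatC ((QGQ*) ⊗ 1)) = 1`. [folklore] -/
theorem deltaCol_mul_unitBondMatC_sOp (hn : 1 ≤ n) (hb : 0 < b) :
    ((b • (1 : Matrix (B4.Idx (pbox M) (d + 1)) (B4.Idx (pbox M) (d + 1)) ℝ) + deltaPol M n) ⊗ₖ (1 : Matrix ι ι ℝ)) * unitBondMatC M ι (tensorId ι (sOp M n b)) = 1 := by
  rw [unitBondMatC_tensorId, ← Matrix.mul_kronecker_mul, mul_unitBondMat_sOp M n hn hb, Matrix.one_mul, Matrix.one_kronecker_one]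

/-- `(unitBondMatC ((QGQ*) ⊗ 1)) * ((b·1 + Δ) ⊗ₖ 1) = 1`. [folklore] -/
theorem unitBondMatC_sOp_mul_deltaCol (hn : 1 ≤ n) (hb : 0 < b) :
    unitBondMatC M ι (tensorId ι (sOp M n b)) * ((b • (1 : Matrix (B4.Idx (pbox M) (d + 1)) (B4.Idx (pbox M) (d + 1)) ℝ) + deltaPol M n) ⊗ₖ (1 : Matrix ι ι ℝ)) = 1 := by
  rw [unitBondMatC_tensorId, ← Matrix.mul_kronecker_mul, unitBondMat_sOp_mul M n hn hb, Matrix.one_mul, Matrix.one_kronecker_one]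

omit [Fintype ι] [NeZero n] in
/-- the colour-lifted (1.66) matrix is `b·1 + (Δ ⊗ₖ 1)` — the shape V-B's `exDress b (Δ ⊗ₖ 1)` reads. [folklore] -/
theorem deltaCol_eq_smul_one_add :
    (b • (1 : Matrix (B4.Idx (pbox M) (d + 1)) (B4.Idx (pbox M) (d + 1)) ℝ) + deltaPol M n) ⊗ₖ (1 : Matrix ι ι ℝ) =
      b • (1 : Matrix (B4.Idx (pbox M) (d + 1) × ι) (B4.Idx (pbox M) (d + 1) × ι) ℝ) + deltaPol M n ⊗ₖ (1 : Matrix ι ι ℝ) := by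
  ext p q
  simp only [kron_one_apply, Matrix.add_apply, Matrix.smul_apply, Matrix.one_apply, smul_eq_mul]
  by_cases h : p.2 = q.2
  · by_cases h1 : p.1 = q.1
    · have hpq : p = q := Prod.ext h1 h
      simp [hpq]
    · have hpq : p ≠ q := by rintro rfl; exact h1 rfl
      simp [h, h1, hpq]
  · have hpq : p ≠ q := by rintro rfl; exact h rfl
    simp [h, hpq]

/-- ★ NONNEGATIVE FORM of `Δ^{(n)} ⊗ₖ 1` (`n ≥ 1`; V-A `form_deltaPol_nonneg` colour by colour). [cite: Balaban1984PropagatorsI, (1.66) p.29 (the form is a sum of squares)] -/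
theorem form_deltaCol_nonneg (hn : 1 ≤ n) (x : B4.Idx (pbox M) (d + 1) × ι → ℝ) : 0 ≤ x ⬝ᵥ ((deltaPol M n ⊗ₖ (1 : Matrix ι ι ℝ)) *ᵥ x) :=
  form_kron_one_nonneg ι (form_deltaPol_nonneg M n hn) x

omit [Fintype ι] [NeZero n] in
/-- SYMMETRY of `Δ^{(n)} ⊗ₖ 1`. [folklore] -/
theorem deltaCol_isSymm : (deltaPol M n ⊗ₖ (1 : Matrix ι ι ℝ)).IsSymm := kron_one_isSymm ι (deltaPol_isSymm M n)

end DeltaCol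

variable (d) in
/-- ★★ **DECAY OF THE COLOUR-LIFTED (1.66) MATRIX, UNIFORM**: `d ≥ 1` ⟹ `∃ c₀ δ₀ > 0`, for every torus, every colour type and every level `n ≥ 1`,
`|(Δ^{(n)} ⊗ₖ 1)((b,i),(b′,j))| ≤ c₀·e^{−δ₀·cdist}` (`kernelDecay166` through `abs_kron_one_le`). [cite: Balaban1984PropagatorsI, (1.66) p.29; King1986, (4.40) p.674 (decay shape)] -/
theorem kernelDecay166_col (hd : 1 ≤ d + 1) : ∃ c₀ δ₀ : ℝ, 0 < c₀ ∧ 0 < δ₀ ∧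
    ∀ (M : Fin (d + 1) → ℕ) [∀ μ, NeZero (M μ)] (ι : Type) [Fintype ι] [DecidableEq ι] (n : ℕ), 1 ≤ n →
      ∀ p q : B4.Idx (pbox M) (d + 1) × ι, |(deltaPol M n ⊗ₖ (1 : Matrix ι ι ℝ)) p q| ≤ c₀ * Real.exp (-(δ₀ * cdist M ι p q)) := by
  obtain ⟨c₀, δ₀, hc₀, hδ₀, hK⟩ := kernelDecay166 (d := d + 1) hd
  refine ⟨c₀, δ₀, hc₀, hδ₀, fun M _ ι _ _ n hn p q => ?_⟩
  have h1 : ∀ x y : B4.Idx (pbox M) (d + 1), |deltaPol M n x y| ≤ c₀ * Real.exp (-(δ₀ * pdist M (one_le_M M) (x.1 : Fin (d + 1) → ℤ) (y.1 : Fin (d + 1) → ℤ))) :=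
    fun x y => hK M n hn x y
  have h2 := abs_kron_one_le ι (fun x y => by positivity) h1 p q
  exact h2

variable (d) in
/-- ★★ **THE η-RATE OF THE COLOUR-LIFTED (1.66) MATRIX, UNIFORM**: `∃ θ₀ δ₁ > 0`, for every torus, colour type, `n₁ ≥ 1`, `n₂ = R·n₁`:
`|(Δ^{(n₂)} ⊗ₖ 1) − (Δ^{(n₁)} ⊗ₖ 1)|((b,i),(b′,j)) ≤ θ₀·n₁⁻¹·e^{−δ₁·cdist}` (`kernelRate166`). [cite: King1986, Lemma 4.5 (4.38) p.674 (rate shape); Balaban1984PropagatorsI, (1.66) p.29] -/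
theorem kernelRate166_col (hd : 1 ≤ d + 1) : ∃ θ₀ δ₁ : ℝ, 0 < θ₀ ∧ 0 < δ₁ ∧
    ∀ (M : Fin (d + 1) → ℕ) [∀ μ, NeZero (M μ)] (ι : Type) [Fintype ι] [DecidableEq ι] (n₁ n₂ R : ℕ), 1 ≤ n₁ → 1 ≤ R → n₂ = R * n₁ →
      ∀ p q : B4.Idx (pbox M) (d + 1) × ι,
        |(deltaPol M n₂ ⊗ₖ (1 : Matrix ι ι ℝ)) p q - (deltaPol M n₁ ⊗ₖ (1 : Matrix ι ι ℝ)) p q| ≤ θ₀ * (n₁ : ℝ)⁻¹ * Real.exp (-(δ₁ * cdist M ι p q)) := by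
  obtain ⟨θ₀, δ₁, hθ₀, hδ₁, hR⟩ := kernelRate166 (d := d + 1) hd
  refine ⟨θ₀, δ₁, hθ₀, hδ₁, fun M _ ι _ _ n₁ n₂ R hn₁ hR1 h p q => ?_⟩
  have h1 : ∀ x y : B4.Idx (pbox M) (d + 1), |(deltaPol M n₂ - deltaPol M n₁) x y| ≤
      θ₀ * (n₁ : ℝ)⁻¹ * Real.exp (-(δ₁ * pdist M (one_le_M M) (x.1 : Fin (d + 1) → ℤ) (y.1 : Fin (d + 1) → ℤ))) :=
    fun x y => by rw [Matrix.sub_apply]; exact hR M n₁ n₂ R hn₁ hR1 h x y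
  have hθn : 0 ≤ θ₀ * (n₁ : ℝ)⁻¹ := by positivity
  rw [kron_one_sub_apply]
  exact abs_kron_one_le ι (fun x y => by positivity) h1 p q

end Summit.QuantumFields.YangMills.BalabanUVNodes.N15.UnitLayerBgCol

end
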